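import Mathlib
import HarnessLib
import Summits.HubbardSuperconductivity.HubbardSuperconductivity.Theorems.KLProgrammeKLRegimeVolumeLimitSixPointSelection

/-!
# Child `KLRegimeVolumeLimit` (stmt-HubbardSuperconductivity-19826 / its gen-4 twin) — the SIX-POINT INSERTION of the finite-`M`
# Schwinger–Dyson form of the VL carrier, part II: the position-space (Fourier) form and the LABEL-UNIFORM majorant
# (seat hubbard-kl-k3c5-p3, technique «OS-positivity-free direct assembly»; part I = `…VolumeLimitSixPointSelection`)

After `…VolumeLimitSchwingerDyson` / `…VolumeLimitOccupation`, clause (i) of the VL text at finite `M` is reduced, for every `U`, to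
the six-point insertion `b(k,σ) = ∫dμ_C e^{−V(U)} (∂⁺_{kσ}W)(∂⁻_{kσ}W)`.  Part I (`…SixPointSelection`) has §1–§3; this module is §4:
* `§1` the SELECTION RULE for the interacting six-point momentum monomials behind `b` (all `U`, no hypothesis on `D`): the
  expectation of `e^{−V} ψ̂⁻_{k₂↑}ψ̂⁺_{k₃↓}ψ̂⁻_{k₄↓} · ψ̂⁺_{k₁↑}ψ̂⁺_{k₃'↓}ψ̂⁻_{k₄'↓}` vanishes unless the two composite labels
  `k₂ − k₃ + k₄` and `k₁ + k₃' − k₄'` agree in (integer frequency, torus momentum) — ONE scaling weight `2^{n(ω)}·χ(k⃗ᵢ)` per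
  coordinate (r2d-p2's conservation weights combined);
* `§2` the COMPOSITE CURRENTS `J⁺ = ψ⁻_↑ψ⁺_↓ψ⁻_↓`, `J⁻ = ψ⁺_↑ψ⁺_↓ψ⁻_↓` of position–time fields expanded in momentum monomials;
* `§3` the orthogonality of the leg phases (discrete time grid `u_j = jβ/N`, `N > 4M`, `sum_exp_freqTransfer_gridTime`; character
  sum over the torus);
* `§4` the FOURIER FORM `βL² · b(k,↑) = −(β/N) Σ_{j<N} Σ_z e^{iω_k u_j} χ_{k⃗}(z) S(z,u_j)`, `S(z,u) = ∫dμ_C e^{−V} J⁺(z,u) J⁻(0,0)` the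
  position-space six-point function (`sixPoint_up_eq_fourier`), whence the LABEL-UNIFORM majorant
  `‖b(k,↑)‖ ≤ max_{z, j} ‖S(z,u_j)‖` (`norm_sixPoint_up_le_of_positionBound`) — the finite-`M` input of the frequency-uniformity
  step (U) of the six-point Matsubara bridge (TAU-BRIDGE.md §3, HOME/hubbard-kl-k3c5-p2): what remains for clause (i) with own
  `M`-threshold, for every `U`, is an `M`-uniform bound and the `M → ∞` convergence of this ONE position-space function at fixed `L`
  (t2's domination machine with a 3+3-leg external word) plus its per-label identification with the Hamiltonian `𝒵` of
  `…ThermalGreenHubbardTorusExact`.  Spin `↓` is the mirror image (`dPlus/dMinus_down_hubbardInteraction`), not restated here.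
Everything is proved; no definition.
-/

noncomputable section

namespace Summit.HubbardSuperconductivity.HubbardSuperconductivity.Theorems.TwoPointAssembly

set_option linter.dupNamespace false -- summit = problem name (single-conjunct summit), D-0017

open Finset Filter Topology Literature.MathematicalPhysics.QuantumLattice Literature.Probability.LatticeModels GrassmannAlgebra
open Summit.HubbardSuperconductivity.HubbardSuperconductivity.Theorems.KLRegimeSplit
open Summit.HubbardSuperconductivity.HubbardSuperconductivity.Theorems.KLProgrammeLegKernels
open scoped ComplexConjugate

variable {L M : ℕ} [NeZero L]

/-! ## §4 The Fourier form of the six-point insertion and its label-uniform majorant -/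

/-- **The six-point insertion `b(k,↑)` expanded over label triples** (`dPlus/dMinus_up_hubbardInteraction`):
`∫e^{−V}(∂⁺_{k↑}W)(∂⁻_{k↑}W) = −(βL²)⁻⁶ Σ_{p,q} [c⁺_k(p)] [c⁻_k(q)] ∫e^{−V} m⁺_p m⁻_q`. -/
theorem sixPoint_up_eq_sum (β U μ : ℝ) (k : FreqMomentum L M) :
    gaussExpect ℂ (hubbardCovariance L M β μ 0)
        (grassmannExp (-(hubbardInteraction L M β U)) *
          (grassmannDeriv ℂ (((k, 0), 0) : HubbardFieldIdx L M) (hubbardInteraction L M β 1) *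
            grassmannDeriv ℂ (((k, 0), 1) : HubbardFieldIdx L M) (hubbardInteraction L M β 1))) =
      -((((1 / (β * (L : ℝ) ^ 2) ^ 3 : ℝ) : ℂ)) * (((1 / (β * (L : ℝ) ^ 2) ^ 3 : ℝ) : ℂ))) *
        ∑ p : FreqMomentum L M × FreqMomentum L M × FreqMomentum L M,
          ∑ q : FreqMomentum L M × FreqMomentum L M × FreqMomentum L M,
            if matsubaraInt M k.1 + matsubaraInt M p.2.1.1 = matsubaraInt M p.1.1 + matsubaraInt M p.2.2.1 ∧
                k.2 + p.2.1.2 = p.1.2 + p.2.2.2 then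
              (if matsubaraInt M q.1.1 + matsubaraInt M q.2.1.1 = matsubaraInt M k.1 + matsubaraInt M q.2.2.1 ∧
                  q.1.2 + q.2.1.2 = k.2 + q.2.2.2 then
                gaussExpect ℂ (hubbardCovariance L M β μ 0)
                  (grassmannExp (-(hubbardInteraction L M β U)) *
                    (psiMinus p.1 0 * (psiPlus p.2.1 1 * psiMinus p.2.2 1) * (psiPlus q.1 0 * (psiPlus q.2.1 1 * psiMinus q.2.2 1))))
              else 0)
            else 0 := by
  rw [dPlus_up_hubbardInteraction, dMinus_up_hubbardInteraction]
  -- bundle the label triples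
  have hP : (∑ k₂ : FreqMomentum L M, ∑ k₃ : FreqMomentum L M, ∑ k₄ : FreqMomentum L M,
      if matsubaraInt M k.1 + matsubaraInt M k₃.1 = matsubaraInt M k₂.1 + matsubaraInt M k₄.1 ∧ k.2 + k₃.2 = k₂.2 + k₄.2 then
        psiMinus k₂ 0 * (psiPlus k₃ 1 * psiMinus k₄ 1) else (0 : HubbardGrassmann L M)) =
      ∑ p : FreqMomentum L M × FreqMomentum L M × FreqMomentum L M,
        if matsubaraInt M k.1 + matsubaraInt M p.2.1.1 = matsubaraInt M p.1.1 + matsubaraInt M p.2.2.1 ∧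
            k.2 + p.2.1.2 = p.1.2 + p.2.2.2 then psiMinus p.1 0 * (psiPlus p.2.1 1 * psiMinus p.2.2 1) else 0 := by
    conv_rhs => rw [Fintype.sum_prod_type]
    refine Finset.sum_congr rfl fun k₂ _ => ?_
    conv_rhs => rw [Fintype.sum_prod_type]
  have hQ : (∑ k₁ : FreqMomentum L M, ∑ k₃ : FreqMomentum L M, ∑ k₄ : FreqMomentum L M,
      if matsubaraInt M k₁.1 + matsubaraInt M k₃.1 = matsubaraInt M k.1 + matsubaraInt M k₄.1 ∧ k₁.2 + k₃.2 = k.2 + k₄.2 then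
        -(psiPlus k₁ 0 * (psiPlus k₃ 1 * psiMinus k₄ 1)) else (0 : HubbardGrassmann L M)) =
      ∑ q : FreqMomentum L M × FreqMomentum L M × FreqMomentum L M,
        if matsubaraInt M q.1.1 + matsubaraInt M q.2.1.1 = matsubaraInt M k.1 + matsubaraInt M q.2.2.1 ∧
            q.1.2 + q.2.1.2 = k.2 + q.2.2.2 then -(psiPlus q.1 0 * (psiPlus q.2.1 1 * psiMinus q.2.2 1)) else 0 := by
    conv_rhs => rw [Fintype.sum_prod_type]
    refine Finset.sum_congr rfl fun k₁ _ => ?_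
    conv_rhs => rw [Fintype.sum_prod_type]
  rw [hP, hQ, smul_mul_smul_comm, mul_smul_comm, map_smul, smul_eq_mul, Finset.sum_mul_sum, neg_mul, ← mul_neg]
  congr 1
  simp_rw [Finset.mul_sum, map_sum]
  rw [← Finset.sum_neg_distrib]
  refine Finset.sum_congr rfl fun p _ => ?_
  rw [← Finset.sum_neg_distrib]
  refine Finset.sum_congr rfl fun q _ => ?_
  split_ifs <;> simp

/-- **The position-space six-point function `S(z,u) = ∫e^{−V} J⁺(z,u) J⁻(0,0)` expanded over label triples.** -/
theorem positionSixPoint_up_eq_sum (β U μ : ℝ) (z : TorusSite 2 L) (u : ℝ) :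
    gaussExpect ℂ (hubbardCovariance L M β μ 0)
        (grassmannExp (-(hubbardInteraction L M β U)) *
          (positionField L M β 1 0 z u * (positionField L M β 0 1 z u * positionField L M β 1 1 z u) *
            (positionField L M β 0 0 0 0 * (positionField L M β 0 1 0 0 * positionField L M β 1 1 0 0)))) =
      ∑ p : FreqMomentum L M × FreqMomentum L M × FreqMomentum L M,
        ∑ q : FreqMomentum L M × FreqMomentum L M × FreqMomentum L M,
          ((((1 / (β * (L : ℝ) ^ 2) : ℝ) : ℂ) * conj (vertexPlaneWave L M β 1 p.1 z u)) *
              ((((1 / (β * (L : ℝ) ^ 2) : ℝ) : ℂ) * conj (vertexPlaneWave L M β 0 p.2.1 z u)) *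
                (((1 / (β * (L : ℝ) ^ 2) : ℝ) : ℂ) * conj (vertexPlaneWave L M β 1 p.2.2 z u))) *
            (((1 / (β * (L : ℝ) ^ 2)) ^ 3 : ℝ) : ℂ)) *
          gaussExpect ℂ (hubbardCovariance L M β μ 0)
            (grassmannExp (-(hubbardInteraction L M β U)) *
              (psiMinus p.1 0 * (psiPlus p.2.1 1 * psiMinus p.2.2 1) * (psiPlus q.1 0 * (psiPlus q.2.1 1 * psiMinus q.2.2 1)))) := by
  rw [currentPlus_up_eq_sum, currentMinus_up_origin_eq_sum, Finset.sum_mul_sum, Finset.mul_sum, map_sum]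
  refine Finset.sum_congr rfl fun p _ => ?_
  rw [Finset.mul_sum, map_sum]
  refine Finset.sum_congr rfl fun q _ => ?_
  rw [smul_mul_smul_comm, mul_smul_comm, map_smul, smul_eq_mul]

omit [NeZero L] in
/-- Moving a double sum inside a double sum (bookkeeping for the Fourier extraction). -/
theorem sum_sum_sum_sum_comm {ι κ P Q : Type*} [Fintype ι] [Fintype κ] [Fintype P] [Fintype Q] (F : ι → κ → P → Q → ℂ) :
    ∑ j, ∑ z, ∑ p, ∑ q, F j z p q = ∑ p, ∑ q, ∑ j, ∑ z, F j z p q := by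
  calc ∑ j, ∑ z, ∑ p, ∑ q, F j z p q = ∑ j, ∑ p, ∑ q, ∑ z, F j z p q := by
        refine Finset.sum_congr rfl fun j _ => ?_
        rw [Finset.sum_comm]
        exact Finset.sum_congr rfl fun p _ => Finset.sum_comm
    _ = ∑ p, ∑ j, ∑ q, ∑ z, F j z p q := Finset.sum_comm
    _ = ∑ p, ∑ q, ∑ j, ∑ z, F j z p q := Finset.sum_congr rfl fun p _ => Finset.sum_comm

/-- **THE FOURIER FORM OF THE SIX-POINT INSERTION** (`β ≠ 0`, every `U`, every finite `(L, M)`, time grid of `N > 4M` points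
`u_j = jβ/N`): with `S(z,u) = ∫dμ_C e^{−V} J⁺(z,u) J⁻(0,0)`, `J⁺ = ψ⁻_↑ψ⁺_↓ψ⁻_↓`, `J⁻ = ψ⁺_↑ψ⁺_↓ψ⁻_↓` (position–time fields),
`βL² · ∫dμ_C e^{−V}(∂⁺_{k↑}W)(∂⁻_{k↑}W) = −(β/N) · Σ_{j<N} Σ_z e^{iω_k u_j} χ_{k⃗}(z) S(z, u_j)` — the six-point insertion at label
`k` is the `k`-th Fourier coefficient of ONE label-free position-space six-point function (time orthogonality on the grid, character
orthogonality on the torus, and the selection rule of `§1` for the second current). -/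
theorem sixPoint_up_eq_fourier {β : ℝ} (hβ : β ≠ 0) (U μ : ℝ) {N : ℕ} (hN : 4 * M < N) (k : FreqMomentum L M) :
    ((β * (L : ℝ) ^ 2 : ℝ) : ℂ) *
        gaussExpect ℂ (hubbardCovariance L M β μ 0)
          (grassmannExp (-(hubbardInteraction L M β U)) *
            (grassmannDeriv ℂ (((k, 0), 0) : HubbardFieldIdx L M) (hubbardInteraction L M β 1) *
              grassmannDeriv ℂ (((k, 0), 1) : HubbardFieldIdx L M) (hubbardInteraction L M β 1))) =
      -((β / N : ℝ) : ℂ) *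
        ∑ j : Fin N, ∑ z : TorusSite 2 L,
          Complex.exp (((matsubaraFreq β M k.1 * gridTime β N j : ℝ) : ℂ) * Complex.I) * torusChar k.2 z *
            gaussExpect ℂ (hubbardCovariance L M β μ 0)
              (grassmannExp (-(hubbardInteraction L M β U)) *
                (positionField L M β 1 0 z (gridTime β N j) *
                    (positionField L M β 0 1 z (gridTime β N j) * positionField L M β 1 1 z (gridTime β N j)) *
                  (positionField L M β 0 0 0 0 * (positionField L M β 0 1 0 0 * positionField L M β 1 1 0 0)))) := by
  have hN0 : (N : ℂ) ≠ 0 := by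
    have : 0 < N := lt_of_le_of_lt (Nat.zero_le _) hN
    exact_mod_cast this.ne'
  set r : ℂ := (((1 / (β * (L : ℝ) ^ 2) ^ 3 : ℝ) : ℂ)) with hr
  set r' : ℂ := (((1 / (β * (L : ℝ) ^ 2)) ^ 3 : ℝ) : ℂ) with hr'
  have hrr : r' = r := by rw [hr, hr']; push_cast; ring
  set G : (FreqMomentum L M × FreqMomentum L M × FreqMomentum L M) → (FreqMomentum L M × FreqMomentum L M × FreqMomentum L M) → ℂ :=
    fun p q => gaussExpect ℂ (hubbardCovariance L M β μ 0)
      (grassmannExp (-(hubbardInteraction L M β U)) *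
        (psiMinus p.1 0 * (psiPlus p.2.1 1 * psiMinus p.2.2 1) * (psiPlus q.1 0 * (psiPlus q.2.1 1 * psiMinus q.2.2 1)))) with hG
  rw [sixPoint_up_eq_sum]
  simp_rw [positionSixPoint_up_eq_sum]
  -- the right side: push the phases in, swap the sums, evaluate the phase sums
  have key : (∑ j : Fin N, ∑ z : TorusSite 2 L,
      Complex.exp (((matsubaraFreq β M k.1 * gridTime β N j : ℝ) : ℂ) * Complex.I) * torusChar k.2 z *
        ∑ p : FreqMomentum L M × FreqMomentum L M × FreqMomentum L M,
          ∑ q : FreqMomentum L M × FreqMomentum L M × FreqMomentum L M,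
            ((((1 / (β * (L : ℝ) ^ 2) : ℝ) : ℂ) * conj (vertexPlaneWave L M β 1 p.1 z (gridTime β N j))) *
                ((((1 / (β * (L : ℝ) ^ 2) : ℝ) : ℂ) * conj (vertexPlaneWave L M β 0 p.2.1 z (gridTime β N j))) *
                  (((1 / (β * (L : ℝ) ^ 2) : ℝ) : ℂ) * conj (vertexPlaneWave L M β 1 p.2.2 z (gridTime β N j)))) *
              r') * G p q) =
      ∑ p : FreqMomentum L M × FreqMomentum L M × FreqMomentum L M,
        ∑ q : FreqMomentum L M × FreqMomentum L M × FreqMomentum L M,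
          (r' * ((if matsubaraInt M k.1 + matsubaraInt M p.2.1.1 = matsubaraInt M p.1.1 + matsubaraInt M p.2.2.1 then (N : ℂ) else 0) *
            (if k.2 + p.2.1.2 = p.1.2 + p.2.2.2 then ((L : ℂ) ^ 2) else 0))) * (r' * G p q) := by
    simp_rw [Finset.mul_sum]
    rw [sum_sum_sum_sum_comm]
    refine Finset.sum_congr rfl fun p _ => Finset.sum_congr rfl fun q _ => ?_
    rw [← sum_sum_phases_currentPlus_up hβ hN k p.1 p.2.1 p.2.2, Finset.sum_mul]
    refine Finset.sum_congr rfl fun j _ => ?_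
    rw [Finset.sum_mul]
    refine Finset.sum_congr rfl fun z _ => ?_
    ring
  rw [key, hrr]
  -- compare term by term
  simp_rw [Finset.mul_sum]
  refine Finset.sum_congr rfl fun p _ => Finset.sum_congr rfl fun q _ => ?_
  by_cases hcp : matsubaraInt M k.1 + matsubaraInt M p.2.1.1 = matsubaraInt M p.1.1 + matsubaraInt M p.2.2.1 ∧
      k.2 + p.2.1.2 = p.1.2 + p.2.2.2
  · rw [if_pos hcp, if_pos hcp.1, if_pos hcp.2]
    by_cases hcq : matsubaraInt M q.1.1 + matsubaraInt M q.2.1.1 = matsubaraInt M k.1 + matsubaraInt M q.2.2.1 ∧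
        q.1.2 + q.2.1.2 = k.2 + q.2.2.2
    · rw [if_pos hcq]
      simp only [hG, hr]
      push_cast
      field_simp
    · -- the second current violates the selection rule
      have hsel : G p q = 0 := by
        rw [hG]
        refine gaussExpect_boltzmann_sixMonomial_up_eq_zero β U μ fun hcomp => hcq ⟨?_, ?_⟩
        · have h1 := hcomp.1; have h2 := hcp.1; omega
        · linear_combination hcomp.2 - hcp.2
      rw [if_neg hcq, hsel]
      ring
  · rw [if_neg hcp]
    have h0 : (if matsubaraInt M k.1 + matsubaraInt M p.2.1.1 = matsubaraInt M p.1.1 + matsubaraInt M p.2.2.1 then (N : ℂ) else 0) *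
        (if k.2 + p.2.1.2 = p.1.2 + p.2.2.2 then ((L : ℂ) ^ 2) else 0) = 0 := by
      rcases not_and_or.mp hcp with h | h
      · rw [if_neg h, zero_mul]
      · rw [if_neg h, mul_zero]
    rw [h0]
    ring

/-- **THE LABEL-UNIFORM MAJORANT** (`β ≠ 0`, `N > 4M`): if the position-space six-point function is bounded by `B` on the torus ×
time grid, `‖S(z, u_j)‖ ≤ B`, then `‖∫dμ_C e^{−V}(∂⁺_{k↑}W)(∂⁻_{k↑}W)‖ ≤ B` for EVERY label `k` — the bound does not see the
frequency or the momentum of the external label. -/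
theorem norm_sixPoint_up_le_of_positionBound {β : ℝ} (hβ : β ≠ 0) (U μ : ℝ) {N : ℕ} (hN : 4 * M < N) (k : FreqMomentum L M)
    {B : ℝ}
    (hB : ∀ (j : Fin N) (z : TorusSite 2 L),
      ‖gaussExpect ℂ (hubbardCovariance L M β μ 0)
          (grassmannExp (-(hubbardInteraction L M β U)) *
            (positionField L M β 1 0 z (gridTime β N j) *
                (positionField L M β 0 1 z (gridTime β N j) * positionField L M β 1 1 z (gridTime β N j)) *
              (positionField L M β 0 0 0 0 * (positionField L M β 0 1 0 0 * positionField L M β 1 1 0 0))))‖ ≤ B) :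
    ‖gaussExpect ℂ (hubbardCovariance L M β μ 0)
        (grassmannExp (-(hubbardInteraction L M β U)) *
          (grassmannDeriv ℂ (((k, 0), 0) : HubbardFieldIdx L M) (hubbardInteraction L M β 1) *
            grassmannDeriv ℂ (((k, 0), 1) : HubbardFieldIdx L M) (hubbardInteraction L M β 1)))‖ ≤ B := by
  have hN0 : 0 < N := lt_of_le_of_lt (Nat.zero_le _) hN
  have hL : (0 : ℝ) < (L : ℝ) := by exact_mod_cast Nat.pos_of_ne_zero (NeZero.ne L)
  have hc : 0 < |β| * (L : ℝ) ^ 2 := by positivity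
  have h := congrArg norm (sixPoint_up_eq_fourier hβ U μ hN k)
  rw [norm_mul, norm_mul, norm_neg, Complex.norm_real, Complex.norm_real, Real.norm_eq_abs, Real.norm_eq_abs, abs_mul, abs_pow,
    Nat.abs_cast, abs_div, Nat.abs_cast] at h
  -- bound the double sum by `N · L² · B`
  have hsum : ‖∑ j : Fin N, ∑ z : TorusSite 2 L,
      Complex.exp (((matsubaraFreq β M k.1 * gridTime β N j : ℝ) : ℂ) * Complex.I) * torusChar k.2 z *
        gaussExpect ℂ (hubbardCovariance L M β μ 0)
          (grassmannExp (-(hubbardInteraction L M β U)) *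
            (positionField L M β 1 0 z (gridTime β N j) *
                (positionField L M β 0 1 z (gridTime β N j) * positionField L M β 1 1 z (gridTime β N j)) *
              (positionField L M β 0 0 0 0 * (positionField L M β 0 1 0 0 * positionField L M β 1 1 0 0))))‖ ≤
      (N : ℝ) * ((L : ℝ) ^ 2 * B) := by
    refine (norm_sum_le _ _).trans ?_
    calc _ ≤ ∑ _j : Fin N, (L : ℝ) ^ 2 * B := Finset.sum_le_sum fun j _ => ?_
      _ = (N : ℝ) * ((L : ℝ) ^ 2 * B) := by rw [Finset.sum_const, Finset.card_univ, Fintype.card_fin, nsmul_eq_mul]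
    refine (norm_sum_le _ _).trans ?_
    calc _ ≤ ∑ _z : TorusSite 2 L, B := Finset.sum_le_sum fun z _ => ?_
      _ = (L : ℝ) ^ 2 * B := by
          rw [Finset.sum_const, Finset.card_univ, nsmul_eq_mul]
          congr 1
          rw [Fintype.card_fun, Fintype.card_fin, ZMod.card, Nat.cast_pow]
    rw [norm_mul, norm_mul, Complex.norm_exp_ofReal_mul_I, norm_torusChar, one_mul, one_mul]
    exact hB j z
  have hle : |β| * (L : ℝ) ^ 2 * ‖gaussExpect ℂ (hubbardCovariance L M β μ 0)
      (grassmannExp (-(hubbardInteraction L M β U)) *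
        (grassmannDeriv ℂ (((k, 0), 0) : HubbardFieldIdx L M) (hubbardInteraction L M β 1) *
          grassmannDeriv ℂ (((k, 0), 1) : HubbardFieldIdx L M) (hubbardInteraction L M β 1)))‖ ≤ |β| * (L : ℝ) ^ 2 * B := by
    rw [h]
    calc |β| / (N : ℝ) * _ ≤ |β| / (N : ℝ) * ((N : ℝ) * ((L : ℝ) ^ 2 * B)) :=
          mul_le_mul_of_nonneg_left hsum (by positivity)
      _ = |β| * (L : ℝ) ^ 2 * B := by
          have hN' : (N : ℝ) ≠ 0 := by exact_mod_cast hN0.ne'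
          field_simp
  exact le_of_mul_le_mul_left hle hc

end Summit.HubbardSuperconductivity.HubbardSuperconductivity.Theorems.TwoPointAssembly

end
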